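import Summits.ResolutionOfSingularities.ResolutionOfSingularities.Theorems.PurelyInseparableDim4ChartAtlasSNCFarRepairCentrePairs
import Summits.ResolutionOfSingularities.ResolutionOfSingularities.Theorems.PurelyInseparableDim4ChartAtlasSNCLocalBaseOffCentre
import Summits.ResolutionOfSingularities.ResolutionOfSingularities.Theorems.PurelyInseparableDim4ChartAtlasCover
import HarnessLib

/-!
# Purely inseparable four-folds `z^p + F(x₁, …, x₄)`: THE FAR-RESONANCE REPAIR ON `W` FOR A PAIR-LIST BOUNDARY — the resonant counterpart of
# PA3c p714892 (typ-3's entry point), cell `res-dim4-pi`, typ-2 g7; HANDOFF OPEN 4/6 at W-level, escaping case `j ∉ S'`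

[OURS · counted 0] (D-0157 DOOR 2; DR-157-C.) Setting of PA3c p714892: `π : W → 𝔸⁵` ANY blowing up along `V(z, x_S)`, chart `j ∈ S`, `b_j = 0`,
re-centring `Θⱼ` of record with `z^p + F ↦ x_j^p (z^p + F₁)`, `F ≠ 0` clean `S`-permissible, `F₁` `S'`-permissible, `j ∉ S'`, `S' ≠ ∅`; old boundary
`E = [(xᵢ + c)·𝒪 : (i, c) ∈ L]` (near `(i, 0)`, far `(i, d)` with `i ∈ S`, `d ≠ 0`, transversal `i ∉ S`; parallel members allowed); `|B_near| ≤ 1`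
(hB1/hB2 of p714892). p714892 needs pairwise distinct active far heights (hH1/hH2); HERE they may coincide at the non-zero heights `hs` (hH1/hH2
are asked only for members whose heights avoid `hs`). PROVED (no `sorry`, no new axiom):

* **`admissible_strictTransform_after_farRepairW_pairs`** — with the repair centre `C_W = 𝓘(closure φⱼ(V(C(hs))))` of `…SNCFarRepairCentrePairs`
  (an admissible centre for `M′`), for ANY blowing up `τ : W″ → W` along `C_W`: `St_τ(Zc)` is REGULAR, inside `supp(M′.transform τ C_W)`, and snc
  with `(M′.transform τ C_W).boundary`. Assembly as in `…SNCFarRepairW` (p719344 transport; model = p719034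
  `admissible_strictTransform_after_manyHeights_farRepair_pairs` at `c′ = 0`; off the centre = p714892 for the reduced pair list).

WORDS: «on W, for pair-list boundaries, escaping case: |B_near| ≤ 1 ⟹ after at most ONE extra blow-up along the far-resonance loci the strict
transform of the escaping global centre is admissible» — the far side of S3-N2 COMPLETE in the currency of typ-3's entry point. Nothing here is
a statement about resolution of singularities in dimension ≥ 4 / characteristic `p` (NOT proved anywhere in this programme). bears_on:
LADDER-RESOLUTION:D157-DOOR2 (res-dim4-pi). Supports stmt-ResolutionOfSingularities-16155 (helper).
-/

-- every declaration of this summit lives under `Summit.ResolutionOfSingularities.ResolutionOfSingularities`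
-- (summit = problem), which the duplicate-namespace linter flags; house convention (cf. the Target file).
set_option linter.dupNamespace false

noncomputable section

open MvPolynomial CategoryTheory AlgebraicGeometry Opposite TopologicalSpace
open AlgebraicGeometry.Scheme.IdealSheafData (ofIdealTop vanishingIdeal)

namespace Summit.ResolutionOfSingularities.ResolutionOfSingularities.Theorems.PIDim4

open Literature.AlgebraicGeometry.Resolution
open Literature.AlgebraicGeometry.Resolution.Hauser2010
open Literature.AlgebraicGeometry.Resolution.AffinePointBlowup (P A γ coord Wtop ξ)
open Literature.Barriers.ResolutionOfSingularities

namespace ChartDictionary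

variable {K : Type} [Field K] {p : ℕ} [hp : Fact p.Prime] [CharP K p]
  {S S' : Finset (Fin 4)} {j : Fin 4} {b : Fin 4 → K} {Θⱼ : A 4 K ≃ₐ[K] A 4 K} {h : MvPolynomial (Fin 4) K}
  {F F₁ : MvPolynomial (Fin 4) K} {W : Scheme.{0}} {π : W ⟶ P 4 K}

/-- **THE FAR-RESONANCE REPAIR ON `W` FOR A PAIR-LIST BOUNDARY (escaping case `j ∉ S'`, `S' ≠ ∅`).** Setting of p714892 with `|B_near| ≤ 1`
(hB1/hB2); `hs` a nodup list of NON-ZERO heights; hH1/hH2 asked only OFF `hs` (far `(i, d)` active with `d + bᵢ h ≠ 0` for all `h ∈ hs`; far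
`(j, c)` with `c + h ≠ 0` for all `h ∈ hs`). For ANY blowing up `τ : W″ → W` along `C_W = 𝓘(closure φⱼ(V(C(hs))))`: `St_τ(Zc)` is REGULAR, inside
`supp(M′.transform τ C_W)`, and snc with `(M′.transform τ C_W).boundary`. -/
theorem admissible_strictTransform_after_farRepairW_pairs [IsAlgClosed K] (hj : j ∈ S) (hjS' : j ∉ S') (hbj : b j = 0) (hF : F ≠ 0)
    (hclean : HauserPerlega.IsClean p F) (h0j : Θⱼ (X 0) = X 0 + rename Fin.succ h) (hsj : ∀ i : Fin 4, Θⱼ (X i.succ) = X i.succ + C (b i))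
    (hπ : IsBlowup π (AffineCoordBlowup.𝓘Λ 4 K (insert 0 (Fin.succ '' (S : Set (Fin 4))))))
    (hperm : (p : ℕ∞) ≤ CentreBlowup.ordAlong S F)
    (hread : Θⱼ (coordBlowupSubst K (insert 0 (Fin.succ '' (S : Set (Fin 4)))) j.succ (hyp p F)) = X j.succ ^ p * hyp p F₁)
    (hperm' : (p : ℕ∞) ≤ CentreBlowup.ordAlong S' F₁) (L : List (Fin 4 × K))
    (hB1 : (j, (0 : K)) ∈ L → ∀ mc ∈ L, mc.1 ∈ S → mc.1 ∈ S' → mc.2 = 0 → b mc.1 = 0)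
    (hB2 : ∀ mc ∈ L, ∀ mc' ∈ L, mc.1 ∈ S → mc'.1 ∈ S → mc.1 ∈ S' → mc'.1 ∈ S' → mc.2 = 0 → mc'.2 = 0 → b mc.1 ≠ 0 → b mc'.1 ≠ 0 →
      mc.1 = mc'.1)
    (hs : List K) (hne : hs ≠ []) (hnd : hs.Nodup) (h0 : ∀ h' ∈ hs, h' ≠ 0)
    (hH1 : ∀ ic ∈ L, ic.1 ∈ S → ic.2 ≠ 0 → ic.1 ∈ S' → b ic.1 ≠ 0 → ∀ c : K, (j, c) ∈ L → c ≠ 0 → (∀ h' ∈ hs, c + h' ≠ 0) →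
      (∀ h' ∈ hs, ic.2 + b ic.1 * h' ≠ 0) → ic.2 ≠ b ic.1 * c)
    (hH2 : ∀ ic ∈ L, ∀ kd ∈ L, ic ≠ kd → ic.1 ∈ S → kd.1 ∈ S → ic.2 ≠ 0 → kd.2 ≠ 0 → ic.1 ∈ S' → kd.1 ∈ S' → b ic.1 ≠ 0 → b kd.1 ≠ 0 →
      (∀ h' ∈ hs, ic.2 + b ic.1 * h' ≠ 0) → (∀ h' ∈ hs, kd.2 + b kd.1 * h' ≠ 0) → ic.2 * b kd.1 ≠ kd.2 * b ic.1)
    {k₀ : Fin 4} (hk₀ : k₀ ∈ S') :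
    haveI : IsIso (CommRingCat.ofHom (Θⱼ : A 4 K →+* A 4 K)) := (inferInstance : IsIso Θⱼ.toRingEquiv.toCommRingCatIso.hom)
    let φⱼ := Spec.map (CommRingCat.ofHom (Θⱼ : A 4 K →+* A 4 K)) ≫ AffineCoordBlowup.chartImm hπ (succ_mem_centreVars hj)
    let Zc := vanishingIdeal (closureImage φⱼ ((AffineCoordBlowup.𝓘Λ 4 K (insert 0 (Fin.succ '' (S' : Set (Fin 4))))).support : Set (P 4 K)))
    let M' := ((⟨hypSheaf p F, L.map fun ic => ofIdealTop (Ideal.span {(γ 4 K).symm (X ic.1.succ + C ic.2)}), p⟩ :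
        MarkedIdeal (P 4 K)).transform π (AffineCoordBlowup.𝓘Λ 4 K (insert 0 (Fin.succ '' (S : Set (Fin 4))))))
    let Cmod := (hs.map fun h' => (AffineCoordBlowup.𝓘Λ 4 K (insert 0 (Fin.succ '' ((insert j S' : Finset (Fin 4)) : Set (Fin 4))))).comap
      (Spec.map (CommRingCat.ofHom ((AffinePointBlowup.translateEquiv (n := 4) (Pi.single j.succ (-h')) : A 4 K ≃ₐ[K] A 4 K) :
        A 4 K →+* A 4 K)))).prod
    let CW := vanishingIdeal (closureImage φⱼ (Cmod.support : Set (P 4 K)))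
    ∀ ⦃W'' : Scheme.{0}⦄ ⦃τ : W'' ⟶ W⦄, IsBlowup τ CW →
      Scheme.IsRegular (strictTransformIdeal τ CW Zc).subscheme ∧
        ((strictTransformIdeal τ CW Zc).support : Set W'') ⊆ (M'.transform τ CW).support ∧
        HasSNCWith (M'.transform τ CW).boundary (strictTransformIdeal τ CW Zc) := by
  intro φⱼ Zc M' Cmod CW W'' τ hτ
  classical
  haveI hisoj : IsIso (CommRingCat.ofHom (Θⱼ : A 4 K →+* A 4 K)) := (inferInstance : IsIso Θⱼ.toRingEquiv.toCommRingCatIso.hom)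
  haveI : IsOpenImmersion φⱼ := inferInstanceAs (IsOpenImmersion
    (Spec.map (CommRingCat.ofHom (Θⱼ : A 4 K →+* A 4 K)) ≫ AffineCoordBlowup.chartImm hπ (succ_mem_centreVars hj)))
  haveI : IsProper π := hπ.isProper
  haveI : IsLocallyNoetherian W := LocallyOfFiniteType.isLocallyNoetherian π
  set Λ : Set (Fin (4 + 1)) := insert 0 (Fin.succ '' (S : Set (Fin 4))) with hΛ
  -- the repair centre package
  obtain ⟨hcomap, hrange, -, -, -, hsncC⟩ := farRepairCentre_package_pairs hj hjS' hbj h0j hsj hπ hperm hread hperm' L hs hne hnd h0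
  -- the hyperplane / quadric data of the chart readings
  let H : Finset (Fin (4 + 1) × K) := insert (j.succ, (0 : K))
    (((L.toFinset.filter fun ic => ic.1 = j).image fun ic => (j.succ, ic.2)) ∪
      ((L.toFinset.filter fun ic => ic.1 ∈ S ∧ ic.1 ≠ j ∧ ic.2 = 0).image fun ic => (ic.1.succ, b ic.1)) ∪
      ((L.toFinset.filter fun ic => ic.1 ∉ S).image fun ic => (ic.1.succ, b ic.1 + ic.2)))
  let FQ : Finset (Fin 4 × K) := L.toFinset.filter fun ic => ic.1 ∈ S ∧ ic.1 ≠ j ∧ ic.2 ≠ 0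
  have hHmem : ∀ ka, ka ∈ H → ka = (j.succ, (0 : K)) ∨ (∃ c, (j, c) ∈ L ∧ ka = (j.succ, c)) ∨
      (∃ i, (i, (0 : K)) ∈ L ∧ i ∈ S ∧ i ≠ j ∧ ka = (i.succ, b i)) ∨ ∃ ic ∈ L, ic.1 ∉ S ∧ ka = (ic.1.succ, b ic.1 + ic.2) := by
    intro ka hka
    simp only [H, Finset.mem_insert, Finset.mem_union, Finset.mem_image, Finset.mem_filter, List.mem_toFinset] at hka
    rcases hka with h | ((⟨ic, ⟨hic, hj'⟩, rfl⟩ | ⟨ic, ⟨hic, hiS, hij, hc0⟩, rfl⟩) | ⟨ic, ⟨hic, hiS⟩, rfl⟩)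
    · exact Or.inl h
    · exact Or.inr (Or.inl ⟨ic.2, by rw [← hj']; exact hic, rfl⟩)
    · exact Or.inr (Or.inr (Or.inl ⟨ic.1, by rw [← hc0]; exact hic, hiS, hij, rfl⟩))
    · exact Or.inr (Or.inr (Or.inr ⟨ic, hic, hiS, rfl⟩))
  have hFQ : ∀ id, id ∈ FQ ↔ id ∈ L ∧ id.1 ∈ S ∧ id.1 ≠ j ∧ id.2 ≠ 0 := fun id => by
    simp only [FQ, Finset.mem_filter, List.mem_toFinset]
  have hEshape := forall_mem_transform_boundary_comap_chart_pairs hj hbj hsj hπ L H (Finset.mem_insert_self _ _)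
    (fun c hc => Finset.mem_insert_of_mem (Finset.mem_union_left _ (Finset.mem_union_left _
      (Finset.mem_image.mpr ⟨(j, c), Finset.mem_filter.mpr ⟨List.mem_toFinset.mpr hc, rfl⟩, rfl⟩))))
    (fun i hi hiS hij => Finset.mem_insert_of_mem (Finset.mem_union_left _ (Finset.mem_union_right _
      (Finset.mem_image.mpr ⟨(i, 0), Finset.mem_filter.mpr ⟨List.mem_toFinset.mpr hi, hiS, hij, rfl⟩, rfl⟩))))
    (fun ic hic hiS => Finset.mem_insert_of_mem (Finset.mem_union_right _
      (Finset.mem_image.mpr ⟨ic, Finset.mem_filter.mpr ⟨List.mem_toFinset.mpr hic, hiS⟩, rfl⟩)))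
    FQ (fun ic hic hiS hij hc => (hFQ ic).mpr ⟨hic, hiS, hij, hc⟩)
  -- the reduced pair list: far members at the heights of `hs` removed
  let bad : Fin 4 × K → Prop := fun ic =>
    (ic.1 ∈ S ∧ ic.1 ≠ j ∧ ic.2 ≠ 0 ∧ ic.1 ∈ S' ∧ ∃ h' ∈ hs, ic.2 + b ic.1 * h' = 0) ∨ (ic.1 = j ∧ ic.2 ≠ 0 ∧ ∃ h' ∈ hs, ic.2 + h' = 0)
  set Lr : List (Fin 4 × K) := L.filter fun ic => decide (¬ bad ic) with hLr
  have hLr_mem : ∀ ic, ic ∈ Lr ↔ ic ∈ L ∧ ¬ bad ic := fun ic => by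
    rw [hLr, List.mem_filter, decide_eq_true_iff]
  -- off the centre: the far positive p714892 for the reduced list
  have hZsnc : HasSNCWith ((Lr.map fun ic => ofIdealTop (Ideal.span {(γ 4 K).symm (X ic.1.succ + C ic.2)})).map
      (strictTransformIdeal π (AffineCoordBlowup.𝓘Λ 4 K Λ)) ++ [(AffineCoordBlowup.𝓘Λ 4 K Λ).comap π]) Zc := by
    have hW := hasSNCWith_transform_boundary_globalCentre_of_far_heights_pairs hj hjS' hbj hF hclean h0j hsj hπ hperm hread hperm' Lr
      (fun hj0 mc hmc => hB1 ((hLr_mem _).mp hj0).1 mc ((hLr_mem mc).mp hmc).1)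
      (fun mc hmc mc' hmc' => hB2 mc ((hLr_mem mc).mp hmc).1 mc' ((hLr_mem mc').mp hmc').1) ?_ ?_
    · rw [MarkedIdeal.transform_boundary] at hW
      exact hW
    · intro ic hic hiS hc hiS' hbi c hjc hc0
      obtain ⟨hicL, hnb⟩ := (hLr_mem ic).mp hic
      obtain ⟨hjcL, hnbj⟩ := (hLr_mem (j, c)).mp hjc
      have hij : ic.1 ≠ j := fun e => hjS' (e ▸ hiS')
      exact hH1 ic hicL hiS hc hiS' hbi c hjcL hc0 (fun h' hh' hc' => hnbj (Or.inr ⟨rfl, hc0, h', hh', hc'⟩))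
        fun h' hh' hc' => hnb (Or.inl ⟨hiS, hij, hc, hiS', h', hh', hc'⟩)
    · intro ic hic kd hkd hne' hiS hkS hc hd hiS' hkS' hbi hbk
      obtain ⟨hicL, hnbi⟩ := (hLr_mem ic).mp hic
      obtain ⟨hkdL, hnbk⟩ := (hLr_mem kd).mp hkd
      have hij : ic.1 ≠ j := fun e => hjS' (e ▸ hiS')
      have hkj : kd.1 ≠ j := fun e => hjS' (e ▸ hkS')
      exact hH2 ic hicL kd hkdL hne' hiS hkS hc hd hiS' hkS' hbi hbk (fun h' hh' hc' => hnbi (Or.inl ⟨hiS, hij, hc, hiS', h', hh', hc'⟩))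
        fun h' hh' hc' => hnbk (Or.inl ⟨hkS, hkj, hd, hkS', h', hh', hc'⟩)
  refine admissible_strictTransform_of_model_offCentre φⱼ M' hrange hsncC ?_
    (isRegular_globalCentre_of_reading hj hbj h0j hsj hπ hperm hread hperm')
    (support_globalCentre_subset_support_transform_of_reading hj hbj h0j hsj hπ hperm hread hperm' _ rfl rfl) hZsnc ?_ hτ
  · -- THE MODEL: the many-heights repair on the `x_j`-chart (c′ = 0), pair-keyed
    intro V' τV hτV
    have hideal : M'.ideal.comap φⱼ = hypSheaf p F₁ := comap_chart_transform_ideal_of_reading hj hbj h0j hsj hπ hperm hread _ rfl rfl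
    have hZc : Zc.comap φⱼ = AffineCoordBlowup.𝓘Λ 4 K (insert 0 (Fin.succ '' (S' : Set (Fin 4)))) := comap_globalCentre _ _
    have hmult : M'.mult = p := rfl
    rw [hcomap] at hτV ⊢
    rw [hZc, hideal, hmult]
    refine admissible_strictTransform_after_manyHeights_farRepair_pairs (b := b) (c' := 0) hjS' hs hne hnd
      (fun h' hh' => by rw [zero_sub, neg_ne_zero]; exact h0 h' hh') H FQ (fun id hid => ((hFQ id).mp hid).2.2.1)
      (fun id hid => by rw [mul_zero, add_zero]; exact ((hFQ id).mp hid).2.2.2) ?_ ?_ ?_ hk₀ ?_ F₁ hperm' hτV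
    · -- (C1) a hyperplane of a quadric's index is the near member of that index
      intro id hid a ha
      obtain ⟨-, hiS, hij, -⟩ := (hFQ id).mp hid
      rcases hHmem _ ha with e | ⟨c, -, e⟩ | ⟨i, -, -, -, e⟩ | ⟨ic, -, hicS, e⟩
      · exact absurd (Fin.succ_injective _ (Prod.mk.inj e).1) hij
      · exact absurd (Fin.succ_injective _ (Prod.mk.inj e).1) hij
      · obtain ⟨e1, e2⟩ := Prod.mk.inj e
        rw [e2, Fin.succ_injective _ e1]
      · exact absurd ((Fin.succ_injective _ (Prod.mk.inj e).1) ▸ hiS) hicS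
    · -- index-`j` hyperplanes vs active quadrics, off the heights `hs`
      intro a ha hah kε hkε hkS' hdk hbk
      obtain ⟨hkεL, hkS, hkj, hd⟩ := (hFQ kε).mp hkε
      rcases hHmem _ ha with e | ⟨c, hcL, e⟩ | ⟨i, -, -, hij', e⟩ | ⟨ic, -, hicS, e⟩
      · rw [(Prod.mk.inj e).2, zero_mul]; exact hd
      · rw [(Prod.mk.inj e).2] at hah ⊢
        by_cases hc : c = 0
        · rw [hc, zero_mul]; exact hd
        · rw [mul_comm]; exact hH1 kε hkεL hkS hd hkS' hbk c hcL hc hah hdk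
      · exact absurd (Fin.succ_injective _ (Prod.mk.inj e).1).symm hij'
      · exact absurd ((Fin.succ_injective _ (Prod.mk.inj e).1) ▸ hj) hicS
    · -- two active quadrics of different indices, off the heights `hs`
      intro kε hkε kε' hkε' hkS' hk'S' hdk hdk' hkk hbk hbk'
      obtain ⟨hkεL, hkS, -, hd⟩ := (hFQ kε).mp hkε
      obtain ⟨hkε'L, hk'S, -, hd'⟩ := (hFQ kε').mp hkε'
      exact hH2 kε hkεL kε' hkε'L (fun e => hkk (by rw [e])) hkS hk'S hd hd' hkS' hk'S' hbk hbk' hdk hdk'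
    · -- the readings
      rw [MarkedIdeal.transform_boundary]
      exact hEshape
  · -- THE REMOVED MEMBERS MEET `Zc` ONLY INSIDE `V(C_W)`
    intro D hD hDE₀ w hw
    rw [MarkedIdeal.transform_boundary] at hD
    rw [List.mem_append, List.mem_map] at hD hDE₀
    obtain ⟨hwD, hwZ⟩ := hw
    -- `D` is the strict transform of a bad far pair `ic ∈ L`
    have hfar : ∃ ic ∈ L, bad ic ∧ D = strictTransformIdeal π (AffineCoordBlowup.𝓘Λ 4 K Λ)
        (ofIdealTop (Ideal.span {(γ 4 K).symm (X ic.1.succ + C ic.2)})) := by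
      rcases hD with ⟨D₀, hD₀, rfl⟩ | hD
      · obtain ⟨ic, hic, rfl⟩ := List.mem_map.mp hD₀
        by_cases hbi : bad ic
        · exact ⟨ic, hic, hbi, rfl⟩
        · exact absurd (Or.inl ⟨_, List.mem_map.mpr ⟨ic, (hLr_mem ic).mpr ⟨hic, hbi⟩, rfl⟩, rfl⟩) hDE₀
      · exact absurd (Or.inr hD) hDE₀
    obtain ⟨ic, hicL, hbi, rfl⟩ := hfar
    have hiS : ic.1 ∈ S := by
      rcases hbi with ⟨hiS, -⟩ | ⟨hij, -⟩
      · exact hiS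
      · rw [hij]; exact hj
    have hc : ic.2 ≠ 0 := by
      rcases hbi with ⟨-, -, hc, -⟩ | ⟨-, hc, -⟩
      · exact hc
      · exact hc
    -- the point lies over `{xᵢ = −c}`, hence in the `xᵢ`-chart
    have hπw : (X ic.1.succ + C ic.2 : A 4 K) ∈ (π w).asIdeal :=
      (mem_support_ofIdealTop_span_γ_symm_iff _ _).mp (mem_support_of_mem_support_strictTransformIdeal hwD)
    have hXi : (X ic.1.succ : A 4 K) ∉ (π w).asIdeal := fun hX => by
      have h1 := (π w).asIdeal.sub_mem hπw hX
      rw [add_sub_cancel_left, C_mem_asIdeal_iff] at h1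
      exact hc h1
    -- … and in the `x_j`-chart
    have hwj : w ∈ Set.range φⱼ := by
      change w ∈ Set.range (Spec.map (CommRingCat.ofHom (Θⱼ : A 4 K →+* A 4 K)) ≫ AffineCoordBlowup.chartImm hπ (succ_mem_centreVars hj))
      rw [range_specMap_comp_chartImm]
      by_cases hij : ic.1 = j
      · have hXj : (X j.succ : A 4 K) ∉ (π w).asIdeal := by rw [← hij]; exact hXi
        exact mem_opensRange_chartImm_of_X_not_mem hπ (succ_mem_centreVars hj) hXj
      · have hiS' : ic.1 ∈ S' := by
          rcases hbi with ⟨-, -, -, hiS', -⟩ | ⟨hij', -⟩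
          · exact hiS'
          · exact absurd hij' hij
        have hwi := mem_opensRange_chartImm_of_X_not_mem hπ (succ_mem_centreVars hiS) hXi
        obtain ⟨Htw, hHtw⟩ := exists_lift_twist hj hbj h0j hsj hperm hread hperm'
        have hZeq := strictTransformIdeal_graph_eq_globalCentre hj hjS' hbj h0j hsj hπ hHtw
        have hwZ' := hwZ
        change w ∈ (Zc.support : Set W) at hwZ'
        rw [show Zc = _ from hZeq.symm] at hwZ'
        exact support_strictTransformIdeal_graph_inter_opensRange_subset hj hjS' (Finset.mem_inter.mpr ⟨hiS', hiS⟩) hπ Htw ⟨hwZ', hwi⟩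
    obtain ⟨y, rfl⟩ := hwj
    -- on the chart: the point lies on the resonance locus of the height of the member
    have hyZ : ∀ m ∈ (insert 0 (Fin.succ '' (S' : Set (Fin 4))) : Set (Fin (4 + 1))), (X m : A 4 K) ∈ y.asIdeal := by
      have h1 : y ∈ (Zc.comap φⱼ).support := (mem_support_comap_iff _ _ y).mpr hwZ
      rw [show Zc.comap φⱼ = AffineCoordBlowup.𝓘Λ 4 K (insert 0 (Fin.succ '' (S' : Set (Fin 4)))) from comap_globalCentre _ _,
        AffineCoordBlowup.support_𝓘Λ, AffineCoordBlowup.mem_CΛ_iff'] at h1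
      exact h1
    have hyD : y ∈ ((strictTransformIdeal π (AffineCoordBlowup.𝓘Λ 4 K Λ)
        (ofIdealTop (Ideal.span {(γ 4 K).symm (X ic.1.succ + C ic.2)}))).comap φⱼ).support := (mem_support_comap_iff _ _ y).mpr hwD
    have hyj : ∃ h' ∈ hs, (X j.succ + C (-h') : A 4 K) ∈ y.asIdeal := by
      by_cases hij : ic.1 = j
      · rcases hbi with ⟨-, hij', -⟩ | ⟨-, -, h', hh', hdh⟩
        · exact absurd hij hij'
        · refine ⟨h', hh', ?_⟩
          have e1 : ic = (j, ic.2) := Prod.ext hij rfl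
          rw [e1] at hyD
          change y ∈ ((strictTransformIdeal π (AffineCoordBlowup.𝓘Λ 4 K Λ) (ofIdealTop (Ideal.span {(γ 4 K).symm (X j.succ + C ic.2)}))).comap
            (Spec.map (CommRingCat.ofHom (Θⱼ : A 4 K →+* A 4 K)) ≫ AffineCoordBlowup.chartImm hπ (succ_mem_centreVars hj))).support at hyD
          rw [comap_recenter_chart_strictTransform_far_self hj hc hsj hπ, hbj, zero_add, mem_support_ofIdealTop_span_γ_symm_iff] at hyD
          rwa [eq_neg_of_add_eq_zero_left hdh] at hyD
      · rcases hbi with ⟨-, -, -, hiS', h', hh', hdh⟩ | ⟨hij', -⟩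
        · refine ⟨h', hh', ?_⟩
          change y ∈ ((strictTransformIdeal π (AffineCoordBlowup.𝓘Λ 4 K Λ) (ofIdealTop (Ideal.span {(γ 4 K).symm (X ic.1.succ + C ic.2)}))).comap
            (Spec.map (CommRingCat.ofHom (Θⱼ : A 4 K →+* A 4 K)) ≫ AffineCoordBlowup.chartImm hπ (succ_mem_centreVars hj))).support at hyD
          rw [comap_recenter_chart_strictTransform_far hj hiS hij hc hsj hπ, hbj, C_0, add_zero, mem_support_ofIdealTop_span_γ_symm_iff]
            at hyD
          have hbk : b ic.1 ≠ 0 := fun hb => hc (by rw [hb, zero_mul, add_zero] at hdh; exact hdh)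
          refine X_add_C_mem_of_tquadric_mem (b := b) (e := fun k => if k = ic.1 then ic.2 else 0) (c' := 0) (k := ic.1) y hbk
            (by rw [if_pos rfl]; exact hdh) ?_ (hyZ ic.1.succ (Set.mem_insert_of_mem _ ⟨ic.1, Finset.mem_coe.mpr hiS', rfl⟩))
          rw [if_pos rfl, C_0, zero_mul, sub_zero]
          exact hyD
        · exact absurd hij' hij
    obtain ⟨h', hh', hyj⟩ := hyj
    -- hence `y ∈ V(C(hs))` and `φⱼ y ∈ V(C_W)`
    have hyC : y ∈ (Cmod.support : Set (P 4 K)) := by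
      rw [SetLike.mem_coe, mem_support_prod_heights_iff]
      refine ⟨h', hh', ?_⟩
      rw [mem_support_comap_spec_translate_𝓘Λ_iff]
      exact X_add_C_mem_insert_of_hyperplane_mem hjS' y (-h') hyj hyZ
    show φⱼ y ∈ CW.support
    have h1 : y ∈ (CW.comap φⱼ).support := by rw [hcomap]; exact hyC
    exact (mem_support_comap_iff _ _ y).mp h1

end ChartDictionary

end Summit.ResolutionOfSingularities.ResolutionOfSingularities.Theorems.PIDim4

end
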